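import Summits.ResolutionOfSingularities.ResolutionOfSingularities.Theorems.FrobeniusLadderFInjectiveMacaulayficationWFixClosedAffineDim2
import Summits.ResolutionOfSingularities.ResolutionOfSingularities.Theorems.FrobeniusLadderFInjectiveMacaulayficationFiniteModificationOfBlowupHolds
import Summits.ResolutionOfSingularities.ResolutionOfSingularities.Theorems.FrobeniusLadderFInjectiveMacaulayficationClosedCentreDimLe2Tame
import Literature.AlgebraicGeometry.Resolution.RegularLocalRingsNormal
import HarnessLib

/-!
# A REGULAR BLOW-UP MODEL of EVERY separated finite-type integral surface (no affineness), and #4β in dimension ≤ 2 modulo Lipman ONLY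
# (crux `FInjectiveMacaulayfication` stmt-ResolutionOfSingularities-15315, chain w45a; res-L1-w45a-plan-1 R16.28 (A2)/R16.30 (2): the DE-AFFINIZATION
# of the dim-≤-2 rung of #4β; discharges door v33's registered stub `stub_closedCentreExistsDimLe2Wild`; prover res-L1-w45a-lead-1)

[OURS · L1 W4.5a · res-L1-w45a-lead-1] Support file (`--supports stmt-ResolutionOfSingularities-15315 --as helper`); NOT a statement of any
manuscript; AI-written (AI review is weaker than expert review); no definition, no named fact introduced (Lipman 1978 =
`Lipman1978SequenceFinite`, BY NAME; S-V is the THEOREM `FiniteModificationOfBlowup.finiteModificationOfBlowupIsBlowup_holds`; «regular local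
rings are normal» is the tree's `isIntegrallyClosed_of_isRegularLocalRing`, Matsumura 19.4).

THE POINT.  The W2 engine `RegularBlowupModelDim2` turns Lipman's tower over the normalisation of `X₁` into ONE blowing up of `X₁`; its only
affine step is the FIRST link `exists_isBlowup_normalizationι` («the normalisation of an AFFINE variety is a blowing up», via a global
function vanishing on the non-normal locus).  For a general `X₁` we do not present the normalisation itself: we present LIPMAN'S FIRST STEP
`lipmanStep.π X₁ f₁ : normalisation(Bl_{Sing X₁} X₁) → X₁` (which the tree defines for every integral `X₁` locally of finite type over `k`)
as a blowing up of `X₁` along a non-zero ideal sheaf with support `Sing X₁` — S-V applied to the blowing up `Bl_{Sing X₁} X₁ → X₁` of the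
reduced singular locus and the finite surjective normalisation of its source, which is a stalk isomorphism over `Reg X₁` because there
`Bl_{Sing}` is a stalk isomorphism onto REGULAR, hence NORMAL, points (`isIntegrallyClosed_of_isRegularLocalRing`,
`isIso_morphismRestrict_of_isIntegralHom_of_normal`).  This is `RegularBlowupModelDim2.exists_isBlowup_step` with the normal surface `S.X`
replaced by the non-normal `X₁` (normality of the surface being blown up is never used there).  The rest of the engine
(`exists_regular_isBlowup_of_iterate`) and W2's `full_of_isBlowup_of_regular` apply verbatim.

* §1 `exists_isBlowup_lipmanStep` — Lipman's first step over ANY integral `X₁` is a blowing up along `Q ≠ ⊥` off whose support `X₁` is normal.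
* §2 `exists_regular_isBlowup_of_lipman` — a REGULAR `Y` and `π : Y → X₁` with `IsBlowup π J`, `J ≠ ⊥`, for every separated finite-type
  integral `X₁` of dimension `≤ 2` (no `IsAffine`).
* §3 `closedCentreExistsDimLe2Wild_of_lipman : Lipman1978SequenceFinite → ClosedCentreDimLe2Tame.ClosedCentreExistsDimLe2Wild` (W2's proof,
  de-affinized) and **`closedCentreExistsDimLe2_of_lipman : Lipman1978SequenceFinite → ClosedCentreRungs.ClosedCentreExistsDimLe2`** — #4β in
  dimension ≤ 2 for EVERY admissible surface, modulo Lipman 1978 only; `stub_closedCentreExistsDimLe2Wild` (door v33) BY NAME in the crux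
  namespace.

[folklore assembly; cite: Liu2002, Thm. 8.3.44 (PDF p. 427); StacksProject, Tags 080B, 02OS, 035S; Matsumura1987, Thm. 19.4]
-/

-- single-problem summit: the doubled namespace component is forced
set_option linter.dupNamespace false

noncomputable section

open AlgebraicGeometry CategoryTheory Literature.AlgebraicGeometry.Resolution TopologicalSpace

namespace Summit.ResolutionOfSingularities.ResolutionOfSingularities.Theorems.FInjectiveMacaulayfication.RegularBlowupModelGeneral

open Summit.ResolutionOfSingularities.ResolutionOfSingularities.Theorems.FInjectiveMacaulayfication
open Summit.ResolutionOfSingularities.ResolutionOfSingularities.Theorems.FInjectiveMacaulayfication.FCForallExistsDimLe2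
open Summit.ResolutionOfSingularities.ResolutionOfSingularities.Theorems.FInjectiveMacaulayfication.RegularBlowupModelDim2

/-! ## §1 Lipman's first step over a possibly non-normal variety is a blowing up -/

/-- **Lipman's first step is a blowing up.**  For an integral `X₁` locally of finite type and quasi-compact over a field,
`lipmanStep.π X₁ f₁ : normalisation(Bl_{Sing X₁} X₁) → X₁` is a blowing up of `X₁` along a non-zero ideal sheaf `Q` with
`supp Q = Sing X₁`; in particular every local ring of `X₁` off `supp Q` is integrally closed (it is regular).  (Stacks 02OS: `Bl_{Sing}` is a
stalk isomorphism over `Reg X₁`, onto regular hence normal local rings; so the normalisation of `Bl_{Sing}` is an isomorphism over the preimage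
of `Reg X₁`, and S-V presents the composite as a blowing up with the same support.) [folklore assembly; cite: StacksProject, Tag 02OS;
Matsumura1987, Thm. 19.4] -/
theorem exists_isBlowup_lipmanStep {k : Type} [Field k] (X₁ : Scheme.{0}) (f₁ : X₁ ⟶ Spec (.of k)) [LocallyOfFiniteType f₁]
    [QuasiCompact f₁] [IsIntegral X₁] :
    ∃ Q : X₁.IdealSheafData, Q ≠ ⊥ ∧ IsBlowup (lipmanStep.π X₁ f₁) Q ∧ (Q.support : Set X₁) = (Scheme.regularLocus X₁)ᶜ ∧
      ∀ y : X₁, y ∉ (Q.support : Set X₁) → IsIntegrallyClosed (X₁.presheaf.stalk y) := by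
  haveI : IsLocallyNoetherian X₁ := LocallyOfFiniteType.isLocallyNoetherian f₁
  haveI : CompactSpace X₁ := QuasiCompact.compactSpace_of_compactSpace f₁
  haveI : IsNoetherian X₁ := ⟨⟩
  have hV : FiniteModificationOfBlowupIsBlowup := FiniteModificationOfBlowup.finiteModificationOfBlowupIsBlowup_holds
  set Q₀ : X₁.IdealSheafData := singularLocusIdeal X₁ f₁ with hQ₀def
  have hb : IsBlowup (singBlowup.π X₁ f₁) Q₀ := blowup.isBlowup _
  have hne : Q₀ ≠ ⊥ := singularLocusIdeal_ne_bot X₁ f₁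
  have hsuppQ₀ : (Q₀.support : Set X₁) = (Scheme.regularLocus X₁)ᶜ := coe_support_singularLocusIdeal X₁ f₁
  -- off `Sing X₁` the local rings of `X₁` are regular, hence integrally closed
  have hN : ∀ y : X₁, y ∉ (Q₀.support : Set X₁) → IsIntegrallyClosed (X₁.presheaf.stalk y) := by
    intro y hy
    rw [hsuppQ₀, Set.mem_compl_iff, not_not] at hy
    haveI : IsRegularLocalRing (X₁.presheaf.stalk y) := (Scheme.mem_regularLocus y).mp hy
    exact isIntegrallyClosed_of_isRegularLocalRing _
  -- `Bl_{Sing} X₁` is normal over the preimage `V` of `Reg X₁`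
  set c : singBlowup X₁ f₁ ⟶ X₁ := singBlowup.π X₁ f₁ with hc
  let V : (singBlowup X₁ f₁).Opens := c ⁻¹ᵁ ⟨((Q₀.support : Set X₁))ᶜ, Q₀.support.isClosed.isOpen_compl⟩
  have hVn : ∀ y ∈ V, IsIntegrallyClosed ((singBlowup X₁ f₁).presheaf.stalk y) := by
    intro y hy
    have hy' : c.base y ∉ (Q₀.support : Set X₁) := hy
    haveI := isIso_stalkMap_of_isBlowup_of_not_mem hb y hy'
    haveI := hN _ hy'
    exact IsIntegrallyClosed.of_equiv (asIso (c.stalkMap y)).commRingCatIsoToRingEquiv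
  -- hence the (finite, surjective) normalisation of `Bl_{Sing} X₁` is an isomorphism over `V`
  have hgen : IsIso ((normalizationι (singBlowup X₁ f₁)).stalkMap (genericPoint (normalization (singBlowup X₁ f₁)))) :=
    (isBirational_normalizationι (singBlowup X₁ f₁) (singBlowup.π X₁ f₁ ≫ f₁)).isIso_stalkMap_genericPoint
  haveI : IsIso (normalizationι (singBlowup X₁ f₁) ∣_ V) :=
    isIso_morphismRestrict_of_isIntegralHom_of_normal (normalizationι (singBlowup X₁ f₁)) hgen V hVn
  have hsurj : Function.Surjective (normalizationι (singBlowup X₁ f₁)).base :=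
    surjective_of_universallyClosed_of_isDominant _
  have hiso : ∀ x₃ : normalization (singBlowup X₁ f₁),
      c.base ((normalizationι (singBlowup X₁ f₁)).base x₃) ∉ (Q₀.support : Set X₁) →
      IsIso ((normalizationι (singBlowup X₁ f₁)).stalkMap x₃) :=
    fun x₃ hx₃ => RegularBlowupModelDim2.isIso_stalkMap_of_isIso_morphismRestrict (normalizationι (singBlowup X₁ f₁)) V x₃ hx₃
  -- S-V
  obtain ⟨J, hJ, hJsupp, hJbl⟩ := hV X₁ (singBlowup X₁ f₁) (normalization (singBlowup X₁ f₁)) Q₀ c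
    (normalizationι (singBlowup X₁ f₁)) inferInstance inferInstance hne hb inferInstance inferInstance hsurj hiso
  refine ⟨J, hJ, ?_, by rw [hJsupp, hsuppQ₀], fun y hy => hN y (by rwa [hJsupp] at hy)⟩
  have e : lipmanStep.π X₁ f₁ = normalizationι (singBlowup X₁ f₁) ≫ c := rfl
  rw [e]
  exact hJbl

/-! ## §2 A regular blow-up model of every separated finite-type integral surface -/

/-- **A REGULAR BLOW-UP MODEL OF A VARIETY OF DIMENSION `≤ 2`, NO AFFINENESS** (modulo Lipman 1978 BY NAME): for an integral separated
`k`-scheme `X₁` of finite type with `dim X₁ ≤ 2` there are a regular `k`-scheme `Y`, `π : Y → X₁` and a non-zero ideal sheaf `J` on `X₁`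
with `IsBlowup π J`.  Dimension `≤ 1`: `Y` = Lipman's first step (the normalisation of `Bl_{Sing} X₁`, regular by
`isRegular_normalization_of_dim_le_one`); dimension `2`: Lipman's sequence on that normal surface (`Lipman1978SequenceFinite`) and the tower
induction `RegularBlowupModelDim2.exists_regular_isBlowup_of_iterate`, started at §1's blow-up presentation of the first step.
[folklore assembly; cite: Liu2002, Thm. 8.3.44 (PDF p. 427)] -/
theorem exists_regular_isBlowup_of_lipman (hL : Lipman1978SequenceFinite.{0}) {k : Type} [Field k] (X₁ : Scheme.{0})
    (f₁ : X₁ ⟶ Spec (.of k)) [IsSeparated f₁] [LocallyOfFiniteType f₁] [QuasiCompact f₁] [IsIntegral X₁]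
    (hdim : topologicalKrullDim X₁ ≤ 2) :
    ∃ (Y : Scheme.{0}) (_ : Y ⟶ Spec (.of k)) (π : Y ⟶ X₁) (J : X₁.IdealSheafData),
      J ≠ ⊥ ∧ IsBlowup π J ∧ Scheme.IsRegular Y := by
  haveI : IsLocallyNoetherian X₁ := LocallyOfFiniteType.isLocallyNoetherian f₁
  haveI : CompactSpace X₁ := QuasiCompact.compactSpace_of_compactSpace f₁
  haveI : IsNoetherian X₁ := ⟨⟩
  have hV : FiniteModificationOfBlowupIsBlowup := FiniteModificationOfBlowup.finiteModificationOfBlowupIsBlowup_holds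
  obtain ⟨Q, -, hbl, -, hN⟩ := exists_isBlowup_lipmanStep X₁ f₁
  rcases le_one_or_eq_two_of_le_two hdim with h1 | h2
  · have h1' : topologicalKrullDim (singBlowup X₁ f₁) ≤ 1 := by rw [singBlowup.topologicalKrullDim_eq X₁ f₁]; exact h1
    exact ⟨lipmanStep X₁ f₁, lipmanStep.π X₁ f₁ ≫ f₁, lipmanStep.π X₁ f₁, Q, ne_bot_of_isBlowup hbl, hbl,
      isRegular_normalization_of_dim_le_one (singBlowup X₁ f₁) NoetherFiniteIntegralClosure_holds (singBlowup.π X₁ f₁ ≫ f₁) h1'⟩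
  · let S : NormalSurface k :=
      { X := lipmanStep X₁ f₁, hom := lipmanStep.π X₁ f₁ ≫ f₁, isSeparated := inferInstance,
        locallyOfFiniteType := inferInstance, quasiCompact := inferInstance, isIntegral := inferInstance,
        normal := lipmanStep.isIntegrallyClosed_stalk X₁ f₁,
        dim_eq := by rw [lipmanStep.topologicalKrullDim_eq X₁ f₁, h2] }
    obtain ⟨n, hn⟩ := hL k S
    exact exists_regular_isBlowup_of_iterate hV X₁ n S (lipmanStep.π X₁ f₁) Q hbl hN hn

/-! ## §3 #4β in dimension ≤ 2 for every admissible surface, modulo Lipman only -/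

/-- **THE WILD RESIDUAL OF #4β IN DIMENSION ≤ 2 IS A THEOREM MODULO LIPMAN 1978** (`ClosedCentreDimLe2Tame.ClosedCentreExistsDimLe2Wild`,
door v33's `stub_closedCentreExistsDimLe2Wild`): W2's proof (`WFixClosedAffineDim2.wfixClosedAffineDim2_of_lipman`) with §2's affine-free
regular blow-up model — the centre is the model's `J ≠ ⊥`; every blowing up along `J` is FULL at every stalk
(`WFixClosedAffineDim2.full_of_isBlowup_of_regular`); and `b ∈ supp J`, for otherwise `𝒪_{X₁,b}` would be isomorphic to a regular stalk of
the model and satisfy the F-clause, contradicting the badness of `b` (non-normality of `b`, Cohen–Macaulayness and the finiteness of the bad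
locus are not used). [folklore assembly; cite: Liu2002, Thm. 8.3.44 (PDF p. 427); StacksProject, Tag 02OS] -/
theorem closedCentreExistsDimLe2Wild_of_lipman (hL : Lipman1978SequenceFinite.{0}) :
    ClosedCentreDimLe2Tame.ClosedCentreExistsDimLe2Wild := by
  intro p hp k _ _ X₁ f₁ hsep hft hqc hint hdim _ _ b _ hb _
  haveI := hsep; haveI := hft; haveI := hqc; haveI := hint
  haveI : Fact p.Prime := ⟨hp⟩
  obtain ⟨Y, g, π, J, hJ, hπ, hreg⟩ := exists_regular_isBlowup_of_lipman hL X₁ f₁ hdim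
  refine ⟨J, hJ, ?_, fun X' π' hπ' x' _ => WFixClosedAffineDim2.full_of_isBlowup_of_regular p g hπ hreg X' π' hπ' x'⟩
  -- `b ∈ supp J`: otherwise `𝒪_{X₁,b}` is isomorphic to a (regular) stalk of `Y`, hence F-closed on parameters
  by_contra hbJ
  obtain ⟨y, hy⟩ := exists_preimage_of_isBlowup_of_not_mem hπ b hbJ
  subst hy
  haveI := isIso_stalkMap_of_isBlowup_of_not_mem hπ y hbJ
  obtain ⟨-, hcl⟩ := RegularPointClause.fiClause_stalk_of_isRegularLocalRing p g y (hreg y)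
  have hclb := DegreeZeroDescent.inlineClause_of_ringEquiv p (asIso (π.stalkMap y)).commRingCatIsoToRingEquiv.symm hcl
  exact hb fun d hd s hs => (hclb d hd s hs).2

/-- **#4β IN DIMENSION ≤ 2 FOR EVERY ADMISSIBLE SURFACE, MODULO LIPMAN 1978 ONLY** (`ClosedCentreRungs.ClosedCentreExistsDimLe2`): the tame
branch `ClosedCentreDimLe2Tame.closedCentreExistsDimLe2_of_lipman_of_wild` (T2 + `PointFixableCentre.pointFixable_h4`) and §3's wild branch.
No affineness, no quasi-projectivity. [folklore assembly; cite: Liu2002, Thm. 8.3.44 (PDF p. 427)] -/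
theorem closedCentreExistsDimLe2_of_lipman (hL : Lipman1978SequenceFinite.{0}) : ClosedCentreRungs.ClosedCentreExistsDimLe2 :=
  ClosedCentreDimLe2Tame.closedCentreExistsDimLe2_of_lipman_of_wild hL (closedCentreExistsDimLe2Wild_of_lipman hL)

end Summit.ResolutionOfSingularities.ResolutionOfSingularities.Theorems.FInjectiveMacaulayfication.RegularBlowupModelGeneral

end
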